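import Mathlib
import Summits.Ventures.DiscreteObjects.Mahler.CensusTraceRoots
import Summits.Ventures.DiscreteObjects.Mahler.CensusListPoly

/-!
# The trace–Graeffe rejection certificate `tgr` (venture `DiscreteObjects`, target L)

Cell `pub-namedobj`, seat `pub-namedobj-mahler-g16`. Framing: lottery ticket; floor = certified bounds/negative ranges.

A cheaper kernel certificate for `B < M(P)` (`P` monic palindromic of degree `2d`, given by its ascending list), replacing the
Graeffe certificate `Cert.grf` of `CensusCertificate` in the degree-20 census: all arithmetic is done on the TRACE polynomial
`Q` of degree `d` (`P(x) = x^d Q(x + 1/x)`), root squaring is the Chebyshev–Graeffe step `y ↦ y² - 2` computed by ONE even/odd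
product `G(w) = E(w)² - w O(w)²` (no parity check needed) and a Taylor shift by `2`, and the final test uses the sharper
reciprocal bound `|e_{k+1}(y)| ≤ 2^{k+1} C(d-1,k+1) + (B^N + B^{-N}) 2^k C(d-1,k)` (`CensusTraceRoots`, `CensusEsymmBound`)
instead of Mahler's `C(2d,k) B^N`.  Measured on the 73611 large-measure survivors of the degree-20 search: mean depth 3.8 on
degree-10 lists instead of 4.6 on degree-20 lists.
* list functions (evaluated by the kernel): `lpEv`/`lpOd`, `lpGr`, `lpSh2`, `chebStep`, `chebIter`, `lpLift`, `lpTrace`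
  (untrusted: its output is VERIFIED by `lpLift`), `tgrCheck`;
* soundness `lt_intMahlerMeasure_of_tgrCheck`: `tgrCheck Bn Bd d m k asc = true → Bn/Bd < M(ofCoeffs asc)`.
-/

namespace Summit.Ventures.DiscreteObjects.Mahler

open Polynomial

/-! ## Even/odd split and the Graeffe product -/

/-- Even-index entries. -/
def lpEv : List ℤ → List ℤ
  | [] => []
  | [a] => [a]
  | a :: _ :: l => a :: lpEv l

/-- Odd-index entries. -/
def lpOd : List ℤ → List ℤ
  | [] => []
  | [_] => []
  | _ :: b :: l => b :: lpOd l

/-- `p(x) = E(x²) + x · O(x²)`. -/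
theorem ofCoeffs_ev_od : ∀ l : List ℤ,
    ofCoeffs l = (ofCoeffs (lpEv l)).comp (X ^ 2) + X * (ofCoeffs (lpOd l)).comp (X ^ 2)
  | [] => by simp [lpEv, lpOd, ofCoeffs_nil]
  | [a] => by simp [lpEv, lpOd, ofCoeffs_cons, ofCoeffs_nil]
  | a :: b :: l => by
    rw [lpEv, lpOd, ofCoeffs_cons, ofCoeffs_cons, ofCoeffs_cons, ofCoeffs_cons, ofCoeffs_ev_od l]
    simp only [add_comp, mul_comp, X_comp, C_comp]
    ring

/-- The Graeffe product via the split: `G = E² - x·O²` (so that `G(x²) = p(x) p(-x)`). -/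
def lpGr (l : List ℤ) : List ℤ :=
  lpAdd (lpMul (lpEv l) (lpEv l)) (lpNeg (0 :: lpMul (lpOd l) (lpOd l)))

/-- `G(x²) = p(x) · p(-x)`. -/
theorem ofCoeffs_lpGr_comp_sq (l : List ℤ) :
    (ofCoeffs (lpGr l)).comp (X ^ 2) = ofCoeffs l * (ofCoeffs l).comp (-X) := by
  have h := ofCoeffs_ev_od l
  set E := ofCoeffs (lpEv l)
  set O := ofCoeffs (lpOd l)
  have hneg : (ofCoeffs l).comp (-X) = E.comp (X ^ 2) - X * O.comp (X ^ 2) := by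
    rw [h]
    simp only [add_comp, mul_comp, X_comp, comp_assoc, pow_comp]
    rw [show ((-X : ℤ[X]) ^ 2) = X ^ 2 by ring]
    ring
  rw [hneg, h, lpGr, ofCoeffs_lpAdd, ofCoeffs_lpMul, ofCoeffs_lpNeg, ofCoeffs_cons, ofCoeffs_lpMul, C_0, add_zero]
  simp only [add_comp, neg_comp, mul_comp, X_comp]
  ring

/-! ## Taylor shift by 2 and the Chebyshev–Graeffe step -/

/-- `(x + 2) · r`. -/
def lpMulXAdd2 (r : List ℤ) : List ℤ := lpAdd (lpSMul 2 r) (0 :: r)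

/-- `p(x + 2)`. -/
def lpSh2 : List ℤ → List ℤ
  | [] => []
  | a :: l => lpAdd [a] (lpMulXAdd2 (lpSh2 l))

/-- `ofCoeffs (lpSh2 l) = p(x + 2)`. -/
theorem ofCoeffs_lpSh2 : ∀ l : List ℤ, ofCoeffs (lpSh2 l) = (ofCoeffs l).comp (X + C 2)
  | [] => by simp [lpSh2, ofCoeffs_nil]
  | a :: l => by
    have ih := ofCoeffs_lpSh2 l
    rw [lpSh2, ofCoeffs_lpAdd, lpMulXAdd2, ofCoeffs_lpAdd, ofCoeffs_lpSMul, ofCoeffs_cons, ofCoeffs_cons, ofCoeffs_nil,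
      ih, ofCoeffs_cons]
    simp only [add_comp, mul_comp, X_comp, C_comp, C_0]
    ring

/-- One Chebyshev–Graeffe step on a trace polynomial of degree `d`: `Q ↦ ((-1)^d G)(y + 2)`, roots `y ↦ y² - 2`. -/
def chebStep (d : ℕ) (Q : List ℤ) : List ℤ :=
  lpSh2 (if d % 2 = 0 then lpGr Q else lpNeg (lpGr Q))

/-- `m` Chebyshev–Graeffe steps. -/
def chebIter (d : ℕ) : ℕ → List ℤ → List ℤ
  | 0, Q => Q
  | m + 1, Q => chebIter d m (chebStep d Q)

/-- `ofCoeffs (chebStep d Q) = ((-1)^d · G).comp (X + 2)` with `G(x²) = Q(x)Q(-x)`. -/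
theorem ofCoeffs_chebStep (d : ℕ) (Q : List ℤ) :
    ofCoeffs (chebStep d Q) = ((-1 : ℤ[X]) ^ d * ofCoeffs (lpGr Q)).comp (X + C 2) := by
  unfold chebStep
  split_ifs with h
  · rw [ofCoeffs_lpSh2, (Nat.even_iff.mpr h).neg_one_pow, one_mul]
  · rw [ofCoeffs_lpSh2, ofCoeffs_lpNeg, (Nat.odd_iff.mpr (by omega)).neg_one_pow]
    simp

/-! ## The reciprocal lift `x^d Q(x + 1/x)` (verification of the trace polynomial) -/

/-- `q · x^d` as a list. -/
def lpMonom (d : ℕ) (q : ℤ) : List ℤ := List.replicate d 0 ++ [q]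

/-- `ofCoeffs (lpMonom d q) = q x^d`. -/
theorem ofCoeffs_lpMonom (q : ℤ) : ∀ d : ℕ, ofCoeffs (lpMonom d q) = C q * X ^ d
  | 0 => by simp [lpMonom, ofCoeffs_cons, ofCoeffs_nil]
  | d + 1 => by
    rw [lpMonom, List.replicate_succ, List.cons_append, ofCoeffs_cons, ← lpMonom, ofCoeffs_lpMonom q d, C_0]
    ring

/-- `x^d Q(x + 1/x)` as a list: `lift d (q + y Q₁(y)) = q x^d + (x² + 1) · lift (d-1) Q₁`. -/
def lpLift : ℕ → List ℤ → List ℤ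
  | _, [] => []
  | d, q :: qs => lpAdd (lpMonom d q) (lpMul [1, 0, 1] (lpLift (d - 1) qs))

/-- **Evaluation identity of the lift:** `lift(β) = β^d · Q(β + β⁻¹)` for `β ≠ 0` and `|Q| ≤ d + 1`. -/
theorem aeval_lpLift {β : ℂ} (hβ : β ≠ 0) :
    ∀ (qs : List ℤ) (d : ℕ), qs.length ≤ d + 1 →
      aeval β (ofCoeffs (lpLift d qs)) = β ^ d * aeval (β + β⁻¹) (ofCoeffs qs)
  | [], d, _ => by simp [lpLift, ofCoeffs_nil]
  | q :: qs, d, hlen => by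
    have h101 : aeval β (ofCoeffs [1, 0, 1]) = β ^ 2 + 1 := by
      simp [ofCoeffs_cons, ofCoeffs_nil]; ring
    have hcons : aeval (β + β⁻¹) (ofCoeffs (q :: qs)) = (β + β⁻¹) * aeval (β + β⁻¹) (ofCoeffs qs) + q := by
      rw [ofCoeffs_cons, map_add, map_mul, aeval_X, aeval_C, algebraMap_int_eq, eq_intCast]
    rw [lpLift, ofCoeffs_lpAdd, ofCoeffs_lpMul, ofCoeffs_lpMonom, map_add, map_mul, map_mul, map_pow, aeval_C,
      aeval_X, algebraMap_int_eq, eq_intCast, h101, hcons]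
    rcases Nat.eq_zero_or_pos d with rfl | hd
    · have hqs : qs = [] := by
        simpa using hlen
      subst hqs
      simp [lpLift, ofCoeffs_nil]
    · rw [aeval_lpLift hβ qs (d - 1) (by simp at hlen; omega)]
      set A := aeval (β + β⁻¹) (ofCoeffs qs)
      have e : β ^ d = β ^ (d - 1) * β := by rw [← pow_succ, Nat.sub_add_cancel hd]
      rw [e]
      have hb : β * β⁻¹ = 1 := mul_inv_cancel₀ hβ
      linear_combination (-(β ^ (d - 1) * A)) * hb

/-- The trace polynomial from the upper half of a palindromic list (UNTRUSTED: verified by `lpLift` in `tgrCheck`):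
`Q(y) = p_d + Σ_k p_{d+k} C_k(y)` with `C_1 = y`, `C_{k+1} = y C_k - C_{k-1}`, `C_0 = 2`. -/
def lpTraceGo : List ℤ → List ℤ → List ℤ → List ℤ
  | [], _, _ => []
  | c :: cs, Cp, Cc => lpAdd (lpSMul c Cc) (lpTraceGo cs Cc (lpAdd (0 :: Cc) (lpNeg Cp)))

/-- The trace polynomial of a palindromic list of length `2d + 1` (untrusted). -/
def lpTrace (d : ℕ) (asc : List ℤ) : List ℤ :=
  match asc.drop d with
  | [] => []
  | pd :: hs => lpAdd [pd] (lpTraceGo hs [2] [0, 1])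

/-! ## The certificate check and its soundness -/

/-- The final coefficient test after `m` Chebyshev–Graeffe steps (`N = 2^m`):
`(Bn^{2N} + Bd^{2N}) 2^k C(d-1,k) + (Bn Bd)^N 2^{k+1} C(d-1,k+1) < |coeff_{d-k-1}(Q_m)| (Bn Bd)^N`. -/
def tgrTest (Bn Bd d m k : ℕ) (Qm : List ℤ) : Bool :=
  decide (((Bn : ℤ) ^ (2 * 2 ^ m) + (Bd : ℤ) ^ (2 * 2 ^ m)) * (2 ^ k * ((d - 1).choose k : ℕ) : ℤ) +
      ((Bn : ℤ) * Bd) ^ (2 ^ m) * (2 ^ (k + 1) * ((d - 1).choose (k + 1) : ℕ) : ℤ) <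
    |Qm.getD (d - (k + 1)) 0| * (((Bn : ℤ) * Bd) ^ (2 ^ m)))

/-- **The `tgr` certificate check** for an ascending list `asc` (monic palindromic of degree `2d`): the trace polynomial is
recomputed and verified through the lift, `m` Chebyshev–Graeffe steps are applied and coefficient `d - k - 1` is tested. -/
def tgrCheck (Bn Bd d m k : ℕ) (asc : List ℤ) : Bool :=
  decide (1 ≤ d) && decide (k + 1 ≤ d) && ((lpTrace d asc).length == d + 1) && ((lpTrace d asc).getD d 0 == 1) &&
    lpEq (lpLift d (lpTrace d asc)) asc && tgrTest Bn Bd d m k (chebIter d m (lpTrace d asc))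

/-- Iterated root squaring on traces. -/
def sqIter : ℕ → Multiset ℂ → Multiset ℂ
  | 0, s => s
  | m + 1, s => sqIter m (s.map fun y => y ^ 2 - 2)

/-- `sqIter` preserves the number of roots. -/
theorem card_sqIter : ∀ (m : ℕ) (s : Multiset ℂ), Multiset.card (sqIter m s) = Multiset.card s
  | 0, _ => rfl
  | m + 1, s => by rw [sqIter, card_sqIter m, Multiset.card_map]

/-- `∏ jouk` over `sqIter m s` is `(∏ jouk over s)^(2^m)`. -/
theorem prod_jouk_sqIter : ∀ (m : ℕ) (s : Multiset ℂ), ((sqIter m s).map jouk).prod = (s.map jouk).prod ^ (2 ^ m)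
  | 0, s => by simp [sqIter]
  | m + 1, s => by rw [sqIter, prod_jouk_sqIter m, prod_jouk_sq_sub_two, ← pow_mul, pow_succ']

/-- One list step is one root step. -/
theorem map_ofCoeffs_chebStep {d : ℕ} {Q : List ℤ} {ys : Multiset ℂ}
    (hQ : (ofCoeffs Q).map (Int.castRingHom ℂ) = (ys.map fun y => X - C y).prod) (hcard : Multiset.card ys = d) :
    (ofCoeffs (chebStep d Q)).map (Int.castRingHom ℂ) = ((ys.map fun y => y ^ 2 - 2).map fun y => X - C y).prod := by
  set G : ℂ[X] := (((-1 : ℤ[X]) ^ d * ofCoeffs (lpGr Q))).map (Int.castRingHom ℂ) with hG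
  have hGsq : G.comp (X ^ 2) = (-1 : ℂ[X]) ^ Multiset.card ys *
      ((ofCoeffs Q).map (Int.castRingHom ℂ) * ((ofCoeffs Q).map (Int.castRingHom ℂ)).comp (-X)) := by
    have h1 : ((ofCoeffs (lpGr Q)).map (Int.castRingHom ℂ)).comp (X ^ 2) =
        (ofCoeffs Q).map (Int.castRingHom ℂ) * ((ofCoeffs Q).map (Int.castRingHom ℂ)).comp (-X) := by
      have := congrArg (Polynomial.map (Int.castRingHom ℂ)) (ofCoeffs_lpGr_comp_sq Q)
      simpa [Polynomial.map_comp] using this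
    rw [hG, hcard, Polynomial.map_mul, mul_comp, h1]
    simp
  have h := chebGraeffe_roots hQ hGsq
  rw [ofCoeffs_chebStep, Polynomial.map_comp, ← h, hG, Polynomial.map_add, Polynomial.map_X, Polynomial.map_C,
    map_ofNat]

/-- `m` list steps are `m` root steps. -/
theorem map_ofCoeffs_chebIter {d : ℕ} : ∀ (m : ℕ) {Q : List ℤ} {ys : Multiset ℂ},
    (ofCoeffs Q).map (Int.castRingHom ℂ) = (ys.map fun y => X - C y).prod → Multiset.card ys = d →
      (ofCoeffs (chebIter d m Q)).map (Int.castRingHom ℂ) = ((sqIter m ys).map fun y => X - C y).prod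
  | 0, _, _, hQ, _ => by simpa [chebIter, sqIter] using hQ
  | m + 1, Q, ys, hQ, hcard => by
    rw [chebIter, sqIter]
    exact map_ofCoeffs_chebIter m (map_ofCoeffs_chebStep hQ hcard) (by rw [Multiset.card_map, hcard])

/-- **Soundness of the `tgr` certificate:** `tgrCheck Bn Bd d m k asc = true` implies `Bn/Bd < M(ofCoeffs asc)`. -/
theorem lt_intMahlerMeasure_of_tgrCheck {Bn Bd d m k : ℕ} (hBn : 0 < Bn) (hBd : 0 < Bd) {asc : List ℤ}
    (h : tgrCheck Bn Bd d m k asc = true) : (Bn : ℝ) / Bd < intMahlerMeasure (ofCoeffs asc) := by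
  unfold tgrCheck at h
  simp only [Bool.and_eq_true, decide_eq_true_eq, beq_iff_eq] at h
  obtain ⟨⟨⟨⟨⟨hd, hk⟩, hlen⟩, hlast⟩, hlift⟩, htest⟩ := h
  set Q := lpTrace d asc with hQdef
  -- the trace polynomial: monic of degree `d`, split over `ℂ`
  obtain ⟨hQmon, hQdeg⟩ := monic_ofCoeffs hlen hlast
  set QC : ℂ[X] := (ofCoeffs Q).map (Int.castRingHom ℂ) with hQC
  have hQCmon : QC.Monic := hQmon.map _
  have hQCdeg : QC.natDegree = d := by rw [hQC, natDegree_map_eq_of_injective (Int.castRingHom ℂ).injective_int, hQdeg]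
  set ys := QC.roots with hys
  have hsplit : QC.Splits := IsAlgClosed.splits QC
  have hcard : Multiset.card ys = d := by rw [hys, ← hQCdeg]; exact (splits_iff_card_roots.mp hsplit)
  have hQprod : QC = (ys.map fun y => X - C y).prod := hsplit.eq_prod_roots_of_monic hQCmon
  -- the polynomial itself is `∏ (X² - y_i X + 1)`
  set P : ℤ[X] := ofCoeffs asc with hP
  have hPlift : P = ofCoeffs (lpLift d Q) := (ofCoeffs_eq_of_lpEq hlift).symm
  have hPC : P.map (Int.castRingHom ℂ) = (ys.map quadOf).prod := by
    apply eq_prod_quadOf_of_eval hQprod hcard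
    intro β hβ
    have h1 := aeval_lpLift hβ Q d (by rw [hlen])
    rw [← hPlift] at h1
    rw [eval_map, ← algebraMap_int_eq, ← aeval_def, h1, hQC, eval_map, ← algebraMap_int_eq, ← aeval_def]
  have hM : intMahlerMeasure P = (ys.map jouk).prod := by
    rw [intMahlerMeasure, hPC, mahlerMeasure_prod_quadOf]
  -- after `m` steps
  set ysm := sqIter m ys with hysm
  have hQm : (ofCoeffs (chebIter d m Q)).map (Int.castRingHom ℂ) = (ysm.map fun y => X - C y).prod :=
    map_ofCoeffs_chebIter m hQprod hcard
  have hcardm : Multiset.card ysm = d := by rw [hysm, card_sqIter, hcard]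
  have hprodm : (ysm.map jouk).prod = intMahlerMeasure P ^ (2 ^ m) := by rw [hysm, prod_jouk_sqIter, hM]
  -- suppose `M(P) ≤ B`; then the coefficient bound contradicts the test
  by_contra hle
  push Not at hle
  set B : ℝ := (Bn : ℝ) / Bd with hB
  have hB0 : 0 < B := by rw [hB]; positivity
  have hM0 : 0 ≤ intMahlerMeasure P := by unfold intMahlerMeasure; exact Polynomial.mahlerMeasure_nonneg _
  have hpow : (ysm.map jouk).prod ≤ B ^ (2 ^ m) := by rw [hprodm]; exact pow_le_pow_left₀ hM0 hle _
  have hbound := norm_coeff_trace_le hQm hcardm hpow (k := k) hk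
  -- the tested coefficient
  have hcoeff : ‖((ofCoeffs (chebIter d m Q)).map (Int.castRingHom ℂ)).coeff (d - (k + 1))‖ =
      (|(chebIter d m Q).getD (d - (k + 1)) 0| : ℝ) := by
    rw [coeff_map, coeff_ofCoeffs, eq_intCast, Complex.norm_intCast]
  rw [hcoeff] at hbound
  -- `joukRad (B^N) · (Bn Bd)^N = Bn^{2N} + Bd^{2N}`
  set N : ℕ := 2 ^ m with hN
  have hBnR : (0 : ℝ) < Bn := by exact_mod_cast hBn
  have hBdR : (0 : ℝ) < Bd := by exact_mod_cast hBd
  have hden : (0 : ℝ) < ((Bn : ℝ) * Bd) ^ N := by positivity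
  have hj : joukRad (B ^ N) * (((Bn : ℝ) * Bd) ^ N) = (Bn : ℝ) ^ (2 * N) + (Bd : ℝ) ^ (2 * N) := by
    rw [joukRad, hB, div_pow, mul_pow, pow_mul, pow_mul]
    field_simp
    ring
  have htest' : (((Bn : ℤ) ^ (2 * N) + (Bd : ℤ) ^ (2 * N)) * (2 ^ k * ((d - 1).choose k : ℕ) : ℤ) +
      ((Bn : ℤ) * Bd) ^ N * (2 ^ (k + 1) * ((d - 1).choose (k + 1) : ℕ) : ℤ) : ℝ) <
      ((|(chebIter d m Q).getD (d - (k + 1)) 0| * (((Bn : ℤ) * Bd) ^ N) : ℤ) : ℝ) := by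
    unfold tgrTest at htest
    rw [decide_eq_true_eq] at htest
    exact_mod_cast htest
  push_cast at htest'
  have hmul := mul_le_mul_of_nonneg_right hbound hden.le
  rw [add_mul, mul_assoc (joukRad (B ^ N)), mul_comm (2 ^ k * ((d - 1).choose k : ℝ)), ← mul_assoc, hj] at hmul
  linarith

end Summit.Ventures.DiscreteObjects.Mahler
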